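import Summits.ValiantsHypothesis.ValiantsHypothesis.Theorems.LacunarySymmetroidMatrixDescartesCensusBoundaryParity

/-!
# `MatrixDescartes` census — W4: the null–definite parity kill on the TWO-ENDED boundary stratum (face `{1,19}`), chamber-uniform

HONEST FRAMING.  Object-search cell `pub-symmetroid`, item `DoorA26 = PosRootLawAt 2 6 19` (stmt-ValiantsHypothesis-19979,
OPEN, typed, never asserted).  Companion of `…CensusBoundaryParity` (face `{1}`) and `…CensusBoundaryParityTop` (face `{19}`):
on the two-ended face both end letters collapse (`S_{i₀} = a·E₁₁`, `S_{k₀} = c·E₂₂`), the `19`-term edge form `1..19` would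
need `18` positive roots with multiplicity; the low-end null–definite triangle still kills it.  Instances for the `−1` core
chambers 1620, 1500, 1227, 1205, 1194, 999, 370 — completing, in the kernel, the three parity-dead faces `{1}`, `{19}`, `{1,19}`
of the seat's table (W4-E1G20 §3; the remaining faces of those fans die by the signature lemma, seat-level + p424712).
Nothing here bounds `ζ_sym(2,6)`, decides `DoorA26`, or bears on `MatrixDescartes` (stmt-ValiantsHypothesis-18050) / `VP ≠ VNP`.

[folklore] Descartes' rule with multiplicity + elementary `2 × 2` sign algebra; no single source.
-/

-- `Summit.ValiantsHypothesis.ValiantsHypothesis.…` repeats a component by the D-0017 layout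
-- (single-conjunct summit), which the `dupNamespace` linter flags; the name is mandated.
set_option linter.dupNamespace false

namespace Summit.ValiantsHypothesis.ValiantsHypothesis.Theorems.LacunarySymmetroidMatrixDescartes.Census

open Polynomial Finset
open scoped BigOperators Polynomial

/-- **Two-ended boundary EIGHTEENS die on a null–definite odd triangle (chamber-uniform).**  Two-ended form of `no_boundary_nineteen_on_chamber_cell_null` (`…CensusBoundaryParity`): the lowest letter `S_{i₀}`
(`σ 0 = (i₀,i₀)`) is NULL along `E₁₁` AND the highest letter `S_{k₀}` (`σ 20 = (k₀,k₀)`) is NULL along `E₂₂` — the boundary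
stratum of the two-ended face `{1,19}` (hull edge `1..19`, `19` terms, `18` roots with multiplicity needed).  Suppose two other letters `S_i, S_j` sit at
diagonal positions `a, b` and the pairs `(i₀,i), (i₀,j), (i,j)` at positions `e, f, g`, with `a + η`, `b + η` even and
`e + f + g + η` odd, and pin the orientation `η` by the sign of `det S_i` (`hs`).  Then the determinant cannot have `18`
positive roots counted with multiplicity. [folklore] -/
theorem no_boundary_eighteen_on_chamber_cell_nullBoth (σ : Fin 21 → Fin 6 × Fin 6) (η : ℕ) (i₀ k₀ i j : Fin 6)
    (a b e f g : Fin 21)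
    (hcert : (∀ p : Fin 6 × Fin 6, ∃ t : Fin 21, σ t = p ∨ σ t = p.swap) ∧ (σ 0 = (i₀, i₀) ∧ σ 20 = (k₀, k₀)) ∧
      (i₀ ≠ i ∧ i₀ ≠ j ∧ i ≠ j) ∧ (k₀ ≠ i ∧ k₀ ≠ j ∧ k₀ ≠ i₀) ∧
      (σ a = (i, i) ∧ σ b = (j, j) ∧ σ e = (i₀, i) ∧ σ f = (i₀, j) ∧ σ g = (i, j)) ∧
      (Even ((a : ℕ) + η) ∧ Even ((b : ℕ) + η) ∧ Odd ((e : ℕ) + f + g + η)))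
    (d : Fin 6 → ℕ) (hd : StrictMono ((fun p : Fin 6 × Fin 6 => d p.1 + d p.2) ∘ σ))
    (S : Fin 6 → Matrix (Fin 2) (Fin 2) ℝ) (hS : ∀ l, (S l).IsSymm)
    (hnull : S i₀ 0 1 = 0 ∧ S i₀ 1 1 = 0) (hnull' : S k₀ 0 0 = 0 ∧ S k₀ 0 1 = 0)
    (hZ : 18 ≤ ((∑ l, ((X : ℝ[X]) ^ d l) • (S l).map C).det.roots.countP (fun t => 0 < t)))
    (hs : 0 < (-1 : ℝ) ^ ((a : ℕ) + η) * (S i 0 0 * S i 1 1 - S i 0 1 ^ 2)) : False := by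
  classical
  obtain ⟨hcov, ⟨h0, h20⟩, ⟨h0i, h0j, hij⟩, ⟨hki, hkj, hk0⟩, ⟨ha, hb, he, hf, hg⟩, ⟨pa, pb, po⟩⟩ := hcert
  set P := (∑ l, ((X : ℝ[X]) ^ d l) • (S l).map C).det with hP_def
  set W := (Finset.univ : Finset (Fin 6 × Fin 6)).image (fun p => d p.1 + d p.2) with hW_def
  have hN : W.card = 21 := card_pairSums_of_chamber σ hcov d hd
  have memW : ∀ u v : Fin 6, d u + d v ∈ W := fun u v =>
    Finset.mem_image.mpr ⟨(u, v), Finset.mem_univ _, rfl⟩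
  have hsym : ∀ l, S l 1 0 = S l 0 1 := fun l => by
    have h := congrFun (congrFun (hS l) 1) 0
    simp only [Matrix.transpose_apply] at h
    exact h.symm
  have hsum : ∀ {t : Fin 21} {u v : Fin 6}, σ t = (u, v) → d u + d v = d (σ t).1 + d (σ t).2 := by
    intro t u v ht; rw [ht]
  have udiag : ∀ {t : Fin 21} {u : Fin 6}, σ t = (u, u) →
      ∀ p : Fin 6 × Fin 6, d p.1 + d p.2 = d u + d u → p = (u, u) := by
    intro t u ht p hp
    rw [hsum ht] at hp
    rcases pair_eq_of_chamber σ hcov d hd t p hp with h | h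
    · rw [h, ht]
    · rw [h, ht]; rfl
  have upair : ∀ {t : Fin 21} {u v : Fin 6}, σ t = (u, v) →
      ∀ p : Fin 6 × Fin 6, d p.1 + d p.2 = d u + d v → p = (u, v) ∨ p = (v, u) := by
    intro t u v ht p hp
    rw [hsum ht] at hp
    rcases pair_eq_of_chamber σ hcov d hd t p hp with h | h
    · left; rw [h, ht]
    · right; rw [h, ht]; rfl
  have rk : ∀ {t : Fin 21} {u v : Fin 6}, σ t = (u, v) → (W.filter (· < d u + d v)).card = t := by
    intro t u v ht
    rw [hsum ht]
    exact card_filter_lt_of_chamber σ hcov d hd t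
  have hdiag : ∀ {t : Fin 21} {u : Fin 6}, σ t = (u, u) → P.coeff (d u + d u) = S u 0 0 * S u 1 1 - S u 0 1 ^ 2 := by
    intro t u ht; rw [hP_def, coeff_det_pencil_two_diag d S u (udiag ht), hsym, sq]
  have hpair : ∀ {t : Fin 21} {u v : Fin 6}, σ t = (u, v) → u ≠ v →
      P.coeff (d u + d v) = S u 0 0 * S v 1 1 + S u 1 1 * S v 0 0 - 2 * (S u 0 1 * S v 0 1) := by
    intro t u v ht huv; rw [hP_def, coeff_det_pencil_two_pair d S huv (upair ht), hsym, hsym]; ring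
  -- the lowest and the highest coefficients vanish on the boundary stratum
  have hlow : P.coeff (d i₀ + d i₀) = 0 := by rw [hdiag h0, hnull.1, hnull.2]; ring
  have htop : P.coeff (d k₀ + d k₀) = 0 := by rw [hdiag h20, hnull'.1, hnull'.2]; ring
  have hlt : d i₀ + d i₀ < d k₀ + d k₀ := by
    have : d (σ 0).1 + d (σ 0).2 < d (σ 20).1 + d (σ 20).2 := hd (by decide)
    rw [h0, h20] at this; exact this
  set W' := (W.erase (d k₀ + d k₀)).erase (d i₀ + d i₀) with hW'
  have hW'card : W'.card = 19 := by
    rw [hW', Finset.card_erase_of_mem, Finset.card_erase_of_mem (memW k₀ k₀), hN]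
    exact Finset.mem_erase.mpr ⟨hlt.ne, memW i₀ i₀⟩
  have hP : P ≠ 0 := by
    intro hP0
    have : P.roots.countP (fun t => 0 < t) = 0 := by rw [hP0]; simp
    omega
  have hsupp : P.support = W' := by
    have hsub : P.support ⊆ W' := by
      intro x hx
      rw [hW', Finset.mem_erase, Finset.mem_erase]
      refine ⟨?_, ?_, ?_⟩
      · rintro rfl; exact (mem_support_iff.mp hx) hlow
      · rintro rfl; exact (mem_support_iff.mp hx) htop
      · have : P.support ⊆ W := by
          rw [hP_def, hW_def, ← sumset_two_eq_pairSums d]; exact support_det_pencil_subset_sumset d S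
        exact this hx
    refine Finset.eq_of_subset_of_card_le hsub ?_
    have h1 := P.roots_countP_pos_le_signVariations
    have h2 := Literature.Computability.AlgebraicComplexity.signVariations_lt_card_support hP
    omega
  have hZ' : P.support.card ≤ P.roots.countP (fun t => 0 < t) + 1 := by rw [hsupp]; omega
  -- ranks in W' are ranks in W less one (the removed sum is the minimum)
  have hmin : ∀ x ∈ W', d i₀ + d i₀ < x ∧ x < d k₀ + d k₀ := by
    intro x hx
    rw [hW', Finset.mem_erase, Finset.mem_erase] at hx
    obtain ⟨hne, hne', hxW⟩ := hx
    rw [hW_def, Finset.mem_image] at hxW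
    obtain ⟨p, _, rfl⟩ := hxW
    obtain ⟨t, ht⟩ : ∃ t : Fin 21, σ t = p ∨ σ t = p.swap := hcov p
    have hval : d p.1 + d p.2 = d (σ t).1 + d (σ t).2 := by
      rcases ht with ht | ht
      · rw [ht]
      · rw [ht, Prod.fst_swap, Prod.snd_swap, add_comm]
    have h0val : d i₀ + d i₀ = d (σ 0).1 + d (σ 0).2 := by rw [h0]
    have h20val : d k₀ + d k₀ = d (σ 20).1 + d (σ 20).2 := by rw [h20]
    rw [hval, h0val, h20val]
    have ht0 : t ≠ 0 := by
      rintro rfl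
      apply hne
      rw [hval, h0val]
    have ht20 : t ≠ 20 := by
      rintro rfl
      apply hne'
      rw [hval, h20val]
    exact ⟨hd (Fin.pos_iff_ne_zero.mpr ht0), hd (show t < 20 by omega)⟩
  have rk' : ∀ x ∈ W', (W'.filter (· < x)).card + 1 = (W.filter (· < x)).card := by
    intro x hx
    have : W.filter (· < x) = insert (d i₀ + d i₀) (W'.filter (· < x)) := by
      ext y
      simp only [hW', Finset.mem_filter, Finset.mem_insert, Finset.mem_erase]
      constructor
      · rintro ⟨hy, hyx⟩
        by_cases h : y = d i₀ + d i₀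
        · exact Or.inl h
        · refine Or.inr ⟨⟨h, ?_, hy⟩, hyx⟩
          rintro rfl
          exact lt_irrefl _ (hyx.trans (hmin x hx).2)
      · rintro (rfl | ⟨⟨_, _, hy⟩, hyx⟩)
        · exact ⟨memW i₀ i₀, (hmin x hx).1⟩
        · exact ⟨hy, hyx⟩
    rw [this, Finset.card_insert_of_notMem]
    simp [hW']
  -- F1 (with multiplicity) in W-rank form
  have F1 : ∀ x y : ℕ, x ∈ W' → y ∈ W' →
      0 < (-1 : ℝ) ^ ((W.filter (· < x)).card + (W.filter (· < y)).card) * (P.coeff x * P.coeff y) := by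
    intro x y hx hy
    have h := pow_rank_mul_coeff_mul_coeff_pos_of_sharp_countP P hZ' (by rw [hsupp]; exact hx)
      (by rw [hsupp]; exact hy)
    rw [hsupp, ← rk' x hx, ← rk' y hy] at *
    have : (-1 : ℝ) ^ ((W'.filter (· < x)).card + 1 + ((W'.filter (· < y)).card + 1))
        = (-1 : ℝ) ^ ((W'.filter (· < x)).card + (W'.filter (· < y)).card) := by
      rw [show (W'.filter (· < x)).card + 1 + ((W'.filter (· < y)).card + 1)
        = ((W'.filter (· < x)).card + (W'.filter (· < y)).card) + 2 by ring, pow_add]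
      norm_num
    rw [this]; exact h
  have memW' : ∀ {t : Fin 21} {u v : Fin 6}, σ t = (u, v) → t ≠ 0 → t ≠ 20 → d u + d v ∈ W' := by
    intro t u v ht ht0 ht20
    rw [hW', Finset.mem_erase, Finset.mem_erase]
    refine ⟨?_, ?_, memW u v⟩
    · intro hEq
      have : d (σ t).1 + d (σ t).2 = d (σ 0).1 + d (σ 0).2 := by rw [ht, h0]; exact hEq
      exact ht0 (hd.injective this)
    · intro hEq
      have : d (σ t).1 + d (σ t).2 = d (σ 20).1 + d (σ 20).2 := by rw [ht, h20]; exact hEq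
      exact ht20 (hd.injective this)
  have ha0 : a ≠ 0 := by rintro rfl; rw [h0] at ha; exact h0i (Prod.mk.inj ha).1
  have hb0 : b ≠ 0 := by rintro rfl; rw [h0] at hb; exact h0j (Prod.mk.inj hb).1
  have he0 : e ≠ 0 := by rintro rfl; rw [h0] at he; exact h0i (Prod.mk.inj he).2
  have hf0 : f ≠ 0 := by rintro rfl; rw [h0] at hf; exact h0j (Prod.mk.inj hf).2
  have hg0 : g ≠ 0 := by rintro rfl; rw [h0] at hg; exact h0i ((Prod.mk.inj hg).1)
  have ha20 : a ≠ 20 := by rintro rfl; rw [h20] at ha; exact hki (Prod.mk.inj ha).1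
  have hb20 : b ≠ 20 := by rintro rfl; rw [h20] at hb; exact hkj (Prod.mk.inj hb).1
  have he20 : e ≠ 20 := by rintro rfl; rw [h20] at he; exact hk0 (Prod.mk.inj he).1
  have hf20 : f ≠ 20 := by rintro rfl; rw [h20] at hf; exact hk0 (Prod.mk.inj hf).1
  have hg20 : g ≠ 20 := by rintro rfl; rw [h20] at hg; exact hki ((Prod.mk.inj hg).1)
  -- twisted signs, anchored at the definite letter `S_i`
  have tw : ∀ {t : Fin 21} {u v : Fin 6}, σ t = (u, v) → t ≠ 0 → t ≠ 20 →
      0 < (-1 : ℝ) ^ ((t : ℕ) + η) * P.coeff (d u + d v) := by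
    intro t u v ht ht0 ht20
    have h1 := F1 (d i + d i) (d u + d v) (memW' ha ha0 ha20) (memW' ht ht0 ht20)
    rw [rk ha, rk ht, hdiag ha] at h1
    have h2 : 0 < ((-1 : ℝ) ^ ((a : ℕ) + (t : ℕ)) * ((S i 0 0 * S i 1 1 - S i 0 1 ^ 2) * P.coeff (d u + d v)))
        * ((-1 : ℝ) ^ ((a : ℕ) + η) * (S i 0 0 * S i 1 1 - S i 0 1 ^ 2)) := mul_pos h1 hs
    have h3 : ((-1 : ℝ) ^ ((a : ℕ) + (t : ℕ)) * ((S i 0 0 * S i 1 1 - S i 0 1 ^ 2) * P.coeff (d u + d v)))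
        * ((-1 : ℝ) ^ ((a : ℕ) + η) * (S i 0 0 * S i 1 1 - S i 0 1 ^ 2))
        = ((-1 : ℝ) ^ ((t : ℕ) + η) * P.coeff (d u + d v))
          * (((-1 : ℝ) ^ (a : ℕ)) ^ 2 * (S i 0 0 * S i 1 1 - S i 0 1 ^ 2) ^ 2) := by
      rw [pow_add, pow_add, pow_add]; ring
    rw [h3] at h2
    have hsq : ((-1 : ℝ) ^ (a : ℕ)) ^ 2 = 1 := by rw [← pow_mul, mul_comm, pow_mul]; norm_num
    rw [hsq, one_mul] at h2
    exact pos_of_mul_pos_left h2 (sq_nonneg _)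
  -- the two definite letters
  have hΔi : 0 < S i 0 0 * S i 1 1 - S i 0 1 ^ 2 := by
    have := tw ha ha0 ha20; rw [pa.neg_one_pow, hdiag ha] at this; linarith
  have hΔj : 0 < S j 0 0 * S j 1 1 - S j 0 1 ^ 2 := by
    have := tw hb hb0 hb20; rw [pb.neg_one_pow, hdiag hb] at this; linarith
  -- the two null–definite pairings and the definite pair
  have hβe : 0 < (-1 : ℝ) ^ ((e : ℕ) + η) * (S i₀ 0 0 * S i 1 1) := by
    have := tw he he0 he20
    simp only [hpair he h0i, hnull.1, hnull.2, zero_mul, mul_zero, sub_zero, add_zero] at this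
    exact this
  have hβf : 0 < (-1 : ℝ) ^ ((f : ℕ) + η) * (S i₀ 0 0 * S j 1 1) := by
    have := tw hf hf0 hf20
    simp only [hpair hf h0j, hnull.1, hnull.2, zero_mul, mul_zero, sub_zero, add_zero] at this
    exact this
  have hβg := tw hg hg0 hg20
  rw [hpair hg hij] at hβg
  have hodd : Odd (((e : ℕ) + η) + ((f : ℕ) + η) + ((g : ℕ) + η)) := by
    obtain ⟨m, hm⟩ := po; exact ⟨m + η, by omega⟩
  have hprod := prod_neg_of_pos_twists_odd hβe hβf hβg hodd
  have htri := mul_mul_polarDet_pos' (S i 0 0) (S i 0 1) (S i 1 1) (S j 0 0) (S j 0 1) (S j 1 1) hΔi hΔj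
  have hq : 0 ≤ S i₀ 0 0 ^ 2 := sq_nonneg _
  have : S i₀ 0 0 * S i 1 1 * (S i₀ 0 0 * S j 1 1) * (S i 0 0 * S j 1 1 + S i 1 1 * S j 0 0 - 2 * (S i 0 1 * S j 0 1))
      = S i₀ 0 0 ^ 2 * (S i 1 1 * S j 1 1 * (S i 0 0 * S j 1 1 + S i 1 1 * S j 0 0 - 2 * (S i 0 1 * S j 0 1))) := by
    ring
  rw [this] at hprod
  have := mul_nonneg hq htri.le
  linarith


/-- **Chamber 1620, `s = −1` (OPEN core cell, e.g. `(0, 7, 9, 20, 25, 37)`): no two-ended boundary eighteen** (`S₀` null along `E₁₁`,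
`S₅` null along `E₂₂`, `det S_1 > 0`; triangle `S₀, S_1, S_4`, positions `1+7+10` even against `s = −1`). [folklore] -/
theorem no_twoEnded_boundary_eighteen_chamber1620_neg (d : Fin 6 → ℕ)
    (hd : StrictMono ((fun p : Fin 6 × Fin 6 => d p.1 + d p.2) ∘
      ![(0, 0), (0, 1), (0, 2), (1, 1), (1, 2), (2, 2), (0, 3), (0, 4), (1, 3), (2, 3), (1, 4), (2, 4), (0, 5), (3, 3), (1, 5), (3, 4), (2, 5), (4, 4), (3, 5), (4, 5), (5, 5)]))
    (S : Fin 6 → Matrix (Fin 2) (Fin 2) ℝ) (hS : ∀ l, (S l).IsSymm)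
    (hnull : S 0 0 1 = 0 ∧ S 0 1 1 = 0) (hnull' : S 5 0 0 = 0 ∧ S 5 0 1 = 0)
    (hs : 0 < S 1 0 0 * S 1 1 1 - S 1 0 1 ^ 2)
    (hZ : 18 ≤ ((∑ l, ((X : ℝ[X]) ^ d l) • (S l).map C).det.roots.countP (fun t => 0 < t))) : False := by
  refine no_boundary_eighteen_on_chamber_cell_nullBoth _ 1 0 5 1 4 3 17 1 7 10 ⟨?_, by decide⟩ d hd S hS hnull hnull' hZ ?_
  · decide
  · norm_num
    linarith [hs]

/-- **Chamber 1500, `s = −1` (OPEN core cell, e.g. `(0, 8, 11, 20, 27, 37)`): no two-ended boundary eighteen** (`S₀` null along `E₁₁`,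
`S₅` null along `E₂₂`, `det S_1 > 0`; triangle `S₀, S_1, S_3`, positions `1+5+8` even against `s = −1`). [folklore] -/
theorem no_twoEnded_boundary_eighteen_chamber1500_neg (d : Fin 6 → ℕ)
    (hd : StrictMono ((fun p : Fin 6 × Fin 6 => d p.1 + d p.2) ∘
      ![(0, 0), (0, 1), (0, 2), (1, 1), (1, 2), (0, 3), (2, 2), (0, 4), (1, 3), (2, 3), (1, 4), (0, 5), (2, 4), (3, 3), (1, 5), (3, 4), (2, 5), (4, 4), (3, 5), (4, 5), (5, 5)]))
    (S : Fin 6 → Matrix (Fin 2) (Fin 2) ℝ) (hS : ∀ l, (S l).IsSymm)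
    (hnull : S 0 0 1 = 0 ∧ S 0 1 1 = 0) (hnull' : S 5 0 0 = 0 ∧ S 5 0 1 = 0)
    (hs : 0 < S 1 0 0 * S 1 1 1 - S 1 0 1 ^ 2)
    (hZ : 18 ≤ ((∑ l, ((X : ℝ[X]) ^ d l) • (S l).map C).det.roots.countP (fun t => 0 < t))) : False := by
  refine no_boundary_eighteen_on_chamber_cell_nullBoth _ 1 0 5 1 3 3 13 1 5 8 ⟨?_, by decide⟩ d hd S hS hnull hnull' hZ ?_
  · decide
  · norm_num
    linarith [hs]

/-- **Chamber 1227, `s = −1` (OPEN core cell, e.g. `(0, 10, 13, 22, 24, 39)`): no two-ended boundary eighteen** (`S₀` null along `E₁₁`,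
`S₅` null along `E₂₂`, `det S_1 > 0`; triangle `S₀, S_1, S_2`, positions `1+2+5` even against `s = −1`). [folklore] -/
theorem no_twoEnded_boundary_eighteen_chamber1227_neg (d : Fin 6 → ℕ)
    (hd : StrictMono ((fun p : Fin 6 × Fin 6 => d p.1 + d p.2) ∘
      ![(0, 0), (0, 1), (0, 2), (1, 1), (0, 3), (1, 2), (0, 4), (2, 2), (1, 3), (1, 4), (2, 3), (2, 4), (0, 5), (3, 3), (3, 4), (4, 4), (1, 5), (2, 5), (3, 5), (4, 5), (5, 5)]))
    (S : Fin 6 → Matrix (Fin 2) (Fin 2) ℝ) (hS : ∀ l, (S l).IsSymm)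
    (hnull : S 0 0 1 = 0 ∧ S 0 1 1 = 0) (hnull' : S 5 0 0 = 0 ∧ S 5 0 1 = 0)
    (hs : 0 < S 1 0 0 * S 1 1 1 - S 1 0 1 ^ 2)
    (hZ : 18 ≤ ((∑ l, ((X : ℝ[X]) ^ d l) • (S l).map C).det.roots.countP (fun t => 0 < t))) : False := by
  refine no_boundary_eighteen_on_chamber_cell_nullBoth _ 1 0 5 1 2 3 7 1 2 5 ⟨?_, by decide⟩ d hd S hS hnull hnull' hZ ?_
  · decide
  · norm_num
    linarith [hs]

/-- **Chamber 1205, `s = −1` (OPEN core cell, e.g. `(0, 10, 17, 26, 29, 37)`): no two-ended boundary eighteen** (`S₀` null along `E₁₁`,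
`S₅` null along `E₂₂`, `det S_1 > 0`; triangle `S₀, S_1, S_2`, positions `1+2+5` even against `s = −1`). [folklore] -/
theorem no_twoEnded_boundary_eighteen_chamber1205_neg (d : Fin 6 → ℕ)
    (hd : StrictMono ((fun p : Fin 6 × Fin 6 => d p.1 + d p.2) ∘
      ![(0, 0), (0, 1), (0, 2), (1, 1), (0, 3), (1, 2), (0, 4), (2, 2), (1, 3), (0, 5), (1, 4), (2, 3), (2, 4), (1, 5), (3, 3), (2, 5), (3, 4), (4, 4), (3, 5), (4, 5), (5, 5)]))
    (S : Fin 6 → Matrix (Fin 2) (Fin 2) ℝ) (hS : ∀ l, (S l).IsSymm)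
    (hnull : S 0 0 1 = 0 ∧ S 0 1 1 = 0) (hnull' : S 5 0 0 = 0 ∧ S 5 0 1 = 0)
    (hs : 0 < S 1 0 0 * S 1 1 1 - S 1 0 1 ^ 2)
    (hZ : 18 ≤ ((∑ l, ((X : ℝ[X]) ^ d l) • (S l).map C).det.roots.countP (fun t => 0 < t))) : False := by
  refine no_boundary_eighteen_on_chamber_cell_nullBoth _ 1 0 5 1 2 3 7 1 2 5 ⟨?_, by decide⟩ d hd S hS hnull hnull' hZ ?_
  · decide
  · norm_num
    linarith [hs]

/-- **Chamber 1194, `s = −1` (OPEN core cell, e.g. `(0, 12, 17, 28, 30, 37)`): no two-ended boundary eighteen** (`S₀` null along `E₁₁`,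
`S₅` null along `E₂₂`, `det S_1 > 0`; triangle `S₀, S_1, S_2`, positions `1+2+5` even against `s = −1`). [folklore] -/
theorem no_twoEnded_boundary_eighteen_chamber1194_neg (d : Fin 6 → ℕ)
    (hd : StrictMono ((fun p : Fin 6 × Fin 6 => d p.1 + d p.2) ∘
      ![(0, 0), (0, 1), (0, 2), (1, 1), (0, 3), (1, 2), (0, 4), (2, 2), (0, 5), (1, 3), (1, 4), (2, 3), (2, 4), (1, 5), (2, 5), (3, 3), (3, 4), (4, 4), (3, 5), (4, 5), (5, 5)]))
    (S : Fin 6 → Matrix (Fin 2) (Fin 2) ℝ) (hS : ∀ l, (S l).IsSymm)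
    (hnull : S 0 0 1 = 0 ∧ S 0 1 1 = 0) (hnull' : S 5 0 0 = 0 ∧ S 5 0 1 = 0)
    (hs : 0 < S 1 0 0 * S 1 1 1 - S 1 0 1 ^ 2)
    (hZ : 18 ≤ ((∑ l, ((X : ℝ[X]) ^ d l) • (S l).map C).det.roots.countP (fun t => 0 < t))) : False := by
  refine no_boundary_eighteen_on_chamber_cell_nullBoth _ 1 0 5 1 2 3 7 1 2 5 ⟨?_, by decide⟩ d hd S hS hnull hnull' hZ ?_
  · decide
  · norm_num
    linarith [hs]

/-- **Chamber 999, `s = −1` (OPEN core cell, e.g. `(0, 13, 23, 30, 34, 39)`): no two-ended boundary eighteen** (`S₀` null along `E₁₁`,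
`S₅` null along `E₂₂`, `det S_1 > 0`; triangle `S₀, S_1, S_4`, positions `1+5+10` even against `s = −1`). [folklore] -/
theorem no_twoEnded_boundary_eighteen_chamber999_neg (d : Fin 6 → ℕ)
    (hd : StrictMono ((fun p : Fin 6 × Fin 6 => d p.1 + d p.2) ∘
      ![(0, 0), (0, 1), (0, 2), (1, 1), (0, 3), (0, 4), (1, 2), (0, 5), (1, 3), (2, 2), (1, 4), (1, 5), (2, 3), (2, 4), (3, 3), (2, 5), (3, 4), (4, 4), (3, 5), (4, 5), (5, 5)]))
    (S : Fin 6 → Matrix (Fin 2) (Fin 2) ℝ) (hS : ∀ l, (S l).IsSymm)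
    (hnull : S 0 0 1 = 0 ∧ S 0 1 1 = 0) (hnull' : S 5 0 0 = 0 ∧ S 5 0 1 = 0)
    (hs : 0 < S 1 0 0 * S 1 1 1 - S 1 0 1 ^ 2)
    (hZ : 18 ≤ ((∑ l, ((X : ℝ[X]) ^ d l) • (S l).map C).det.roots.countP (fun t => 0 < t))) : False := by
  refine no_boundary_eighteen_on_chamber_cell_nullBoth _ 1 0 5 1 4 3 17 1 5 10 ⟨?_, by decide⟩ d hd S hS hnull hnull' hZ ?_
  · decide
  · norm_num
    linarith [hs]

/-- **Chamber 370, `s = −1` (OPEN core cell, e.g. `(0, 15, 17, 26, 29, 39)`): no two-ended boundary eighteen** (`S₀` null along `E₁₁`,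
`S₅` null along `E₂₂`, `det S_1 > 0`; triangle `S₀, S_1, S_4`, positions `1+4+11` even against `s = −1`). [folklore] -/
theorem no_twoEnded_boundary_eighteen_chamber370_neg (d : Fin 6 → ℕ)
    (hd : StrictMono ((fun p : Fin 6 × Fin 6 => d p.1 + d p.2) ∘
      ![(0, 0), (0, 1), (0, 2), (0, 3), (0, 4), (1, 1), (1, 2), (2, 2), (0, 5), (1, 3), (2, 3), (1, 4), (2, 4), (3, 3), (1, 5), (3, 4), (2, 5), (4, 4), (3, 5), (4, 5), (5, 5)]))
    (S : Fin 6 → Matrix (Fin 2) (Fin 2) ℝ) (hS : ∀ l, (S l).IsSymm)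
    (hnull : S 0 0 1 = 0 ∧ S 0 1 1 = 0) (hnull' : S 5 0 0 = 0 ∧ S 5 0 1 = 0)
    (hs : 0 < S 1 0 0 * S 1 1 1 - S 1 0 1 ^ 2)
    (hZ : 18 ≤ ((∑ l, ((X : ℝ[X]) ^ d l) • (S l).map C).det.roots.countP (fun t => 0 < t))) : False := by
  refine no_boundary_eighteen_on_chamber_cell_nullBoth _ 1 0 5 1 4 5 17 1 4 11 ⟨?_, by decide⟩ d hd S hS hnull hnull' hZ ?_
  · decide
  · norm_num
    linarith [hs]

end Summit.ValiantsHypothesis.ValiantsHypothesis.Theorems.LacunarySymmetroidMatrixDescartes.Census
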